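import Summits.RiemannHypothesis.RiemannHypothesis.Theorems.WeilGroundStateGroundStateSimpleEvenIncrementSplit
import Literature.NumberTheory.LFunctions.WeilArchDensityPanels
import HarnessLib

/-!
# RiemannHypothesis / GroundBarta — rung 4 (`EvenWinsBeyondArch`, stmt-RiemannHypothesis-18807 / 18085):
# the deflated Temple L-side, A-layer I — the archimedean energy of a windowed polynomial through panels

Helper file (`--supports`), RH-free, no definitions, no named facts.  Prover A, speedrun unit `sr-gb-rung-a` (gen 2).

For a rational coefficient list `p` (`ExpPoly.Poly`) and a rational half-width `b > 0`, the window function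
`v = 𝟙_{[-b,b]} · p` has increments `D_t(v) = 2‖p‖² − 2 C_pp(t) = t · E(t)` on `[0, 2b]` with the EXACT
correlation polynomial `C_pp = Poly.corr p p b` (`ExpPoly/Correlation.lean`) and `E = Poly.incTail (2 C_pp)`, and
`D_t(v) = 2‖p‖²` beyond `2b` (`GroundStateSimpleEven.incs_*`).  Hence (`dt_archEnergy_windowPoly_eq`)

  `∫_{(0,∞)} ρ(t) D_t(v) dt = ∫₀^{2b} g(t) E(t) dt + 2‖p‖² ∫_{(2b,∞)} ρ`,  `g(t) = t ρ(t)`,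

with integrability, and (`dt_archEnergy_windowPoly_eq_panels`) the bulk integral is the sum over `N` panels of
half-width `h = b/N` of `∫_{-h}^{h} g(c_k + ρ) · q_k(ρ) dρ` with the exactly re-centred polynomials
`q_k = BPoly.subst (BPoly.taylor E) [c_k]`, `c_k = (2k+1)h` (`WeilArchDensityPanels.lean`).  Each panel integral
is then certified by a Taylor model of `g` (`WeilArchDensityPanelTM.lean`) and the tail by the exponential
series (`weilArchDensity_tail_eq_sum_add`): the A-layer (arch part) of the G3 certificates of the window cells,
free of the catastrophic cancellation of the monomial moment expansion (`G3-PLAN v3`).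

References: E. Bombieri, Rend. Mat. Acc. Lincei (9) 11 (2000) 183–233, Thm 2 [Bombieri2000Weil].
-/

set_option linter.dupNamespace false

noncomputable section

open MeasureTheory Set Filter intervalIntegral
open scoped Topology BigOperators

namespace Summit.RiemannHypothesis.RiemannHypothesis.Theorems.EvenWinsBeyondArch

open Literature.NumberTheory.LFunctions Literature.Analysis.ValidatedNumerics.ExpPoly
open Summit.RiemannHypothesis.RiemannHypothesis.Theorems.GroundStateSimpleEven
  (incs_weilIncrement_eq incs_weilIncrement_of_ge incs_integral_mul_of_le)

/-- **Increments of a windowed polynomial on `[0, 2b]`**: `D_t(𝟙_{[-b,b]} p) = t · E(t)`,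
`E = incTail (2 · corr p p b)`. [folklore] -/
theorem dt_weilIncrement_windowPoly_of_le (p : Poly) {b : ℚ} (hb : 0 < b) {t : ℝ} (ht : 0 ≤ t)
    (ht2 : t ≤ 2 * (b : ℝ)) :
    weilIncrement (fun x : ℝ ↦ (((Set.Icc (-(b : ℝ)) b).indicator (fun x ↦ Poly.eval p x) x : ℝ) : ℂ)) t =
      t * Poly.eval (Poly.incTail (Poly.smul 2 (Poly.corr p p b))) t := by
  have hbr : (0 : ℝ) < b := by exact_mod_cast hb
  rw [incs_weilIncrement_eq (Poly.continuous_eval p) hbr ht, incs_integral_mul_of_le _ ht2,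
    ← Poly.eval_zero_sub_eval, Poly.eval_smul, Poly.eval_smul, Poly.eval_corr, Poly.eval_corr]
  simp only [sub_zero, add_zero, Rat.cast_ofNat, pow_two]

/-- **Increments of a windowed polynomial beyond `2b`**: `D_t = 2‖p‖²`. [folklore] -/
theorem dt_weilIncrement_windowPoly_of_ge (p : Poly) {b : ℚ} (hb : 0 < b) {t : ℝ} (ht : 2 * (b : ℝ) ≤ t) :
    weilIncrement (fun x : ℝ ↦ (((Set.Icc (-(b : ℝ)) b).indicator (fun x ↦ Poly.eval p x) x : ℝ) : ℂ)) t =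
      2 * ∫ x in (-(b : ℝ))..b, Poly.eval p x ^ 2 :=
  incs_weilIncrement_of_ge (Poly.continuous_eval p) (by exact_mod_cast hb) ht

/-- **The archimedean energy of a windowed polynomial**: integrability on `(0, ∞)` and
`∫_{(0,∞)} ρ D = ∫₀^{2b} g·E + 2‖p‖² ∫_{(2b,∞)} ρ`. [cite: Bombieri2000Weil, Thm 2] -/
theorem dt_archEnergy_windowPoly_eq (p : Poly) {b : ℚ} (hb : 0 < b) :
    IntegrableOn (fun t ↦ weilArchDensity t *
        weilIncrement (fun x : ℝ ↦ (((Set.Icc (-(b : ℝ)) b).indicator (fun x ↦ Poly.eval p x) x : ℝ) : ℂ)) t) (Set.Ioi 0) ∧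
      ∫ t in Set.Ioi 0, weilArchDensity t *
          weilIncrement (fun x : ℝ ↦ (((Set.Icc (-(b : ℝ)) b).indicator (fun x ↦ Poly.eval p x) x : ℝ) : ℂ)) t =
        (∫ t in (0 : ℝ)..(2 * b), weilArchDensityG t * Poly.eval (Poly.incTail (Poly.smul 2 (Poly.corr p p b))) t) +
          2 * (∫ x in (-(b : ℝ))..b, Poly.eval p x ^ 2) * ∫ t in Set.Ioi (2 * (b : ℝ)), weilArchDensity t := by
  set E : Poly := Poly.incTail (Poly.smul 2 (Poly.corr p p b)) with hE
  set v : ℝ → ℂ := fun x : ℝ ↦ (((Set.Icc (-(b : ℝ)) b).indicator (fun x ↦ Poly.eval p x) x : ℝ) : ℂ) with hv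
  set G2 : ℝ := 2 * ∫ x in (-(b : ℝ))..b, Poly.eval p x ^ 2 with hG2
  have hbr : (0 : ℝ) < b := by exact_mod_cast hb
  have h2b : (0 : ℝ) < 2 * b := by positivity
  -- the two pieces
  have hEq1 : EqOn (fun t ↦ weilArchDensity t * weilIncrement v t) (fun t ↦ weilArchDensityG t * Poly.eval E t)
      (Set.Ioc 0 (2 * (b : ℝ))) := by
    intro t ht
    simp only [hv]
    rw [dt_weilIncrement_windowPoly_of_le p hb ht.1.le ht.2, weilArchDensity_mul_mul ht.1]
  have hEq2 : EqOn (fun t ↦ weilArchDensity t * weilIncrement v t) (fun t ↦ weilArchDensity t * G2)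
      (Set.Ioi (2 * (b : ℝ))) := by
    intro t ht
    simp only [hv]
    rw [dt_weilIncrement_windowPoly_of_ge p hb (le_of_lt ht)]
  have hI1 : IntegrableOn (fun t ↦ weilArchDensityG t * Poly.eval E t) (Set.Ioc 0 (2 * (b : ℝ))) :=
    (intervalIntegrable_iff_integrableOn_Ioc_of_le h2b.le).1
      (intervalIntegrable_weilArchDensityG_mul le_rfl h2b.le (Poly.continuous_eval E))
  have hI2 : IntegrableOn (fun t ↦ weilArchDensity t * G2) (Set.Ioi (2 * (b : ℝ))) :=
    (weilArchDensity_tail_eq_sum_add h2b 0).1.mul_const G2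
  have hI1' : IntegrableOn (fun t ↦ weilArchDensity t * weilIncrement v t) (Set.Ioc 0 (2 * (b : ℝ))) :=
    hI1.congr_fun hEq1.symm measurableSet_Ioc
  have hI2' : IntegrableOn (fun t ↦ weilArchDensity t * weilIncrement v t) (Set.Ioi (2 * (b : ℝ))) :=
    hI2.congr_fun hEq2.symm measurableSet_Ioi
  have hunion : Set.Ioc (0 : ℝ) (2 * b) ∪ Set.Ioi (2 * b) = Set.Ioi 0 := Ioc_union_Ioi_eq_Ioi h2b.le
  refine ⟨?_, ?_⟩
  · rw [← hunion]; exact hI1'.union hI2'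
  · rw [← hunion, setIntegral_union (Ioc_disjoint_Ioi_same) measurableSet_Ioi hI1' hI2',
      setIntegral_congr_fun measurableSet_Ioc hEq1, setIntegral_congr_fun measurableSet_Ioi hEq2,
      ← intervalIntegral.integral_of_le h2b.le, MeasureTheory.integral_mul_const]
    ring

/-- **The archimedean energy through panels**: with `N ≥ 1` panels of half-width `h = b/N` centred at
`c_k = (2k+1)h`,
`∫_{(0,∞)} ρ D = Σ_{k<N} ∫_{-h}^{h} g(c_k + ρ) · (subst (taylor E) [c_k])(ρ) dρ + 2‖p‖² ∫_{(2b,∞)} ρ`. [folklore] -/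
theorem dt_archEnergy_windowPoly_eq_panels (p : Poly) {b : ℚ} (hb : 0 < b) {N : ℕ} (hN : 0 < N) :
    ∫ t in Set.Ioi 0, weilArchDensity t *
        weilIncrement (fun x : ℝ ↦ (((Set.Icc (-(b : ℝ)) b).indicator (fun x ↦ Poly.eval p x) x : ℝ) : ℂ)) t =
      (∑ k ∈ Finset.range N, ∫ ρ in (-((b / N : ℚ) : ℝ))..((b / N : ℚ) : ℝ),
        weilArchDensityG ((((2 * k + 1 : ℕ) : ℚ) * (b / N) : ℚ) + ρ) *
          Poly.eval (BPoly.subst (BPoly.taylor (Poly.incTail (Poly.smul 2 (Poly.corr p p b))))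
            [((2 * k + 1 : ℕ) : ℚ) * (b / N)]) ρ) +
        2 * (∫ x in (-(b : ℝ))..b, Poly.eval p x ^ 2) * ∫ t in Set.Ioi (2 * (b : ℝ)), weilArchDensity t := by
  rw [(dt_archEnergy_windowPoly_eq p hb).2]
  have hh : 0 < b / N := div_pos hb (by exact_mod_cast hN)
  have hcast : (2 * (b : ℝ)) = 2 * N * ((b / N : ℚ) : ℝ) := by
    have hN' : (N : ℝ) ≠ 0 := by exact_mod_cast hN.ne'
    push_cast
    field_simp
  rw [hcast, integral_weilArchDensityG_mul_eval_eq_sum _ hh N]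

end Summit.RiemannHypothesis.RiemannHypothesis.Theorems.EvenWinsBeyondArch

end
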